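import Literature.MathematicalPhysics.QuantumFieldTheory.Balaban1983to89.B9Eq3126EnergyBallTowerClosed
import Literature.MathematicalPhysics.QuantumFieldTheory.Balaban1983to89.B7Eq43AveragedSmallnessLinearFeed

/-!
# `Balaban1983to89.B9Eq3126EnergyBallTowerTwoWindows` — T. Bałaban, *Propagators for lattice gauge theories in a background field*, Commun. Math. Phys. **99**
# (1985) 389–434 [Balaban1985BackgroundPropagators] Thm 3.4 p. 400, Thm 3.11 p. 416, (3.126) p. 420, Thm 3.13 ∕ (3.153) p. 426 and (3.35)–(3.37) p. 396 AT
# `k = n+1` AVERAGING LEVELS ON PRINT's DIAGONAL `ηL^{n+1} = 1`: **THE `k`-LEVEL BALL IN THE ENERGY CURRENCY ON PRINT's CLASS (3.35) — NO OPERATOR LETTER,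
# NO PROFILE BINDER** — the row OWNER t4-ne9-p1 g87's junction `B9Eq3126EnergyBallTowerClosed.exists_energy_ball_diagonal_closed` (every operator letter
# inhabited: `C_R` by this lineage's `B9Eq325RLipschitzSqrtTowerPackaged`, `C_{K,1}`∕`C_{K,U}` by ne9-leaf-02's files) with the level-profile binders
# `εU ∕ hεU ∕ hUε ∕ hεg ∕ r ∕ hUb` STRUCK by this lineage's α-LINEAR feed (`B7Eq43AveragedSmallnessLinearFeed`): the background valued in an averaging-closed
# `S ≤ U1`, unitary, bonds `αη`-close, plaquettes `αη²`-close — the OWNER's OFFER -G (ONLINE gen 87)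

statement-level skeleton of published theorems with citation tags; proofs where landed; nothing here is a claim about the Yang–Mills mass gap

CITATION HEADER (lean-in-tree rule).  Audit cell `pub-balaban`, sub-cell `t4`, BINDER row NE9; filed by NE9 formalisation-swarm leaf prover 03
(`b2b-balaban-t4-ne9-formalise-leaf-03`, gen 66), INTENT I-ne9leaf03-g66-G = the row OWNER t4-ne9-p1 g87's OFFER («your two-window re-issue of THIS junction via -A
is the natural -G — yours if you want it»), TAKEN (journal W-7).  Sources READ in the held text `paper:balaban1985-cmp99-background-propagators` pp. 396, 400,
416, 420, 426.  Objects BY NAME: the owner's `laplaceAk`, `QkW`, `RofUk`, `hessOp`; `greenK`, `G1LatticeK`, `H1LatticeK`, `frakGLatticeK`, `covCurlL2K`,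
`covDivL2K`; nothing re-declared, 0 `def`.

THE PRINT (verbatim).  p. 400, Thm 3.4: *«There exists a positive constant α₁ such that the operators G′(U), (Q′(U)G′²(U)Q′*(U))⁻¹, R(U), G(U) extend to
configurations U′U for α ≤ α₁ as analytic functions of A … describing these analytic extensions as small perturbations of the operators depending on U only»*;
p. 426: *«(3.147), (3.153) permit us to reduce properties of 𝔓, 𝔊 to the corresponding properties of G′, (Q′G′²Q′*)⁻¹, G₁, (QG₁Q*)⁻¹ … Theorem 3.13»*; p. 396
(3.35): bonds `αη`, plaquettes `αη²` — the averaged configurations' smallness (3.37) is a consequence.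

WHAT IS PROVED (sorry-free; proof lane — 0 `def`; [folklore] binder plumbing over landed files).
* **`exists_energy_ball_twoWindows`** — `∃ α₀ C > 0` (closed in `(d, a, L, M_φ, M_φ′, C_τ, ρ_w)`; `C = K·C^{junction}(r = 1∕L)`, `K = 1 + 512(d+1)(d+4)`) BEFORE
  `∀ n η (ηL^{n+1} = 1) (3 ≤ L^{n+1}) c₀ c₁ (c₀(L^{n+1})^d = c₁) (|η|^d∕c₀ ≤ ρ_w) m U (E162's data) S (AvgClosed) (U(b) ∈ S) α (0 ≤ α ≤ α₀) (U(b)* = U(b)⁻¹)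
  (‖U(b) − 1‖ ≤ αη) (‖U(∂p) − 1‖ ≤ αη²)`, ANY `hposU hpos1 hQU hQ1`: the junction's four blocks VERBATIM — [G] `‖G_k(U)y‖` + rows `≤ C‖y‖` and
  `‖G_k(U)y − G_k(1)y‖` + rows `≤ Cα‖y‖`; [HQG] the three rows of `H_kQ_kG_ky` `≤ C‖y‖`; [𝔊] `‖𝔊_k(U)x‖` + rows `≤ C‖x‖` and `‖𝔊_k(U)x − 𝔊_k(1)x‖` + rows
  `≤ Cα‖x‖`; [H] `‖H_k(U)b‖` + rows `≤ C‖b‖` and `‖H_k(U)b − H_k(1)b‖` + rows `≤ Cα‖b‖` (flat letters written out as in the host).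
HONEST SCOPE.  [folklore]; FIRST order at the flat point on the diagonal ONLY; the two WINDOWS, unitarity, E162's data, the trace letters, `ρ_w`, `1 ≤ d`,
`3 ≤ L^{n+1}` and the four witnesses stay HYPOTHESES (the witnesses are theorems on the class); the fine-bond window is NOT derived from plaquettes (torus holonomies;
per cube = the IMS road); no kernel bound, no decay, NOT the (N)-reading ((117)'s `√(c₁#β)` and `M_∇ = 2|η|⁻¹` are the chart consumer's — print's Thm 3.13 decay);
«NE9 ⇐ the named binders»; NE9 NOT PRINTED ∕ NOT PROVED; NOT summit progress (cell pub-balaban: row NE9 WALLED ON A MODEL (O-NE9-1; #5 UNRULED); spine PROVED 0/9;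
rung (B)+1 finite T⁴ — NOT infinite volume, NOT mass gap, NOT BetaPertH, NOT Clay; HONEST DEPENDENCY: continuum YM on T⁴ ⇐ BetaPertH ∧ nine spine estimates (0/9
proved); BetaPertH ⇐ (D1) ∧ (D4) ∧ CAP+tail; G-an2-4 gates asym, D1 and NE2/3/4).  NEW file; nothing modified.  Net new unproved facts: 0.
-/

noncomputable section

open scoped InnerProductSpace ComplexConjugate BigOperators

namespace Literature.MathematicalPhysics.QuantumFieldTheory.Balaban1983to89.B9Eq3126EnergyBallTowerTwoWindows

open B4Sect5Torus (TSite)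
open B9SectCLatticeCarrier (Bond)
open B11Eq103H1Complex (SiteL2K BondL2K covDivL2K greenK G1LatticeK H1LatticeK frakGLatticeK)
open B9Eq310HessianOperator (adTransportW hessOp covCurlL2K)
open B9Eq310DeltaPrime (plaqHolU)
open B9Eq315QTorus (perCfg cornerSite)
open B9Eq315QTower (towerP UlevOf)
open B9Eq315QTowerFlat (perCfg_UlevOf_one_mem_U1 norm_Wcx_UlevOf_one_sub_one_le)
open B9Eq326OperatorTower (laplaceAk QkW RofUk)
open B7Prop1Explicit (U1 Wcx boxVec)
open B7Prop2Explicit (AvgClosed)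
open B9Eq3126EnergyBallTowerClosed (exists_energy_ball_diagonal_closed)
open B7Eq43AveragedSmallnessLinearFeed (twoWindows_linear_feed)

variable {d : ℕ} (hd : 1 ≤ d) (L : ℕ) [NeZero L] (hL : 1 ≤ L) (hL2 : 2 ≤ L)
  {𝔸 : Type*} [NormedRing 𝔸] [NormedAlgebra ℂ 𝔸] [CompleteSpace 𝔸] [NormOneClass 𝔸] [StarRing 𝔸] [NormedStarGroup 𝔸] [StarModule ℂ 𝔸]
  {W : Type*} [NormedAddCommGroup W] [InnerProductSpace ℂ W] [FiniteDimensional ℂ W] (φ : W ≃ₗ[ℂ] 𝔸)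
  {Mφ Mφ' : ℝ} (hMφ : 0 ≤ Mφ) (hMφ' : 0 ≤ Mφ') (hφ : ∀ w, ‖φ w‖ ≤ Mφ * ‖w‖) (hφ' : ∀ X, ‖φ.symm X‖ ≤ Mφ' * ‖X‖)
  {a : ℝ} (ha : 0 < a) (τ : 𝔸 →ₗ[ℂ] ℂ) {Cτ : ℝ} (hτ : ∀ X, ‖τ X‖ ≤ Cτ * ‖X‖) (hCτ : 0 ≤ Cτ) {ρw : ℝ} (hρw : 0 ≤ ρw)
  (hτ₁ : ∀ X : 𝔸, τ (star X) = conj (τ X)) (hτ₂ : ∀ X Y : 𝔸, τ (X * Y) = τ (Y * X))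
  (hφτ : ∀ X Y : 𝔸, ⟪φ.symm X, φ.symm Y⟫_ℂ = τ (star X * Y))

include hd hL2 hMφ hMφ' hφ hφ' ha hτ hCτ hρw hτ₁ hτ₂ hφτ

set_option maxRecDepth 8192 in
/-- **THE `k`-LEVEL BALL IN THE ENERGY CURRENCY ON PRINT's CLASS (3.35) — NO OPERATOR LETTER, NO PROFILE BINDER**: there are `α₀, C > 0` (closed in
`(d, a, L, M_φ, M_φ′, C_τ, ρ_w)`) such that for every `n` with `3 ≤ L^{n+1}`, `η` (`ηL^{n+1} = 1`), `c₀, c₁` (`c₀(L^{n+1})^d = c₁`, `|η|^d∕c₀ ≤ ρ_w`), `m`,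
background `U` of E162's data valued in an averaging-closed `S`, `0 ≤ α ≤ α₀`, unitary, in the two windows `‖U(b) − 1‖ ≤ αη`, `‖U(∂p) − 1‖ ≤ αη²`, and ANY
witnesses `hposU hpos1 hQU hQ1`: [G] bounds and flat-point Lipschitz rows of `G_k`, [HQG] rows of `H_kQ_kG_k`, [𝔊] bounds and Lipschitz rows of `𝔊_k`, [H]
bounds and Lipschitz rows of `H_k`, all in the flat energy norm — the OWNER's `exists_energy_ball_diagonal_closed` at `r = 1∕L`, fed at `β = Kα` by
`twoWindows_linear_feed` (bounds: `C ≤ KC`; Lipschitz rows: `C·(Kα) = (KC)·α`). [cite: Balaban1985BackgroundPropagators, Thm 3.4 p.400, Thm 3.11 p.416, (3.126) p.420, Thm 3.13 p.426, (3.153) p.426, (3.35)–(3.37) p.396; Balaban1985Variational, (45)–(46) p.285, (110)–(111) p.294; Balaban1985Averaging, Prop. 2 (52)–(54) p.26] -/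
theorem exists_energy_ball_twoWindows :
    ∃ α₀ C : ℝ, 0 < α₀ ∧ 0 < C ∧ ∀ (n : ℕ) (η : ℝ), η * (L : ℝ) ^ (n + 1) = 1 → 3 ≤ L ^ (n + 1) →
      ∀ (c₀ c₁ : ℝ) [Fact (0 < c₀)] [Fact (0 < c₁)], c₀ * ((L : ℝ) ^ (n + 1)) ^ d = c₁ → |η| ^ d / c₀ ≤ ρw →
      ∀ (m : Fin d → ℕ) [∀ i, NeZero (m i)] (U : Bond d (towerP L m (n + 1)) → 𝔸ˣ) (αU : ℕ → ℝ) (hα1 : ∀ j, αU j ≤ 1 / 64)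
        (hU1 : ∀ (j : ℕ) (x : B7Prop1Explicit.Site d) (κ : Fin d), perCfg (towerP L m (j + 1)) (UlevOf L m (n + 1) U j) x κ ∈ U1 𝔸)
        (hreg : ∀ (j : ℕ) (y : TSite d (towerP L m j)) (κ : Fin d) (r : Fin d → Fin L),
          ‖((Wcx L (perCfg (towerP L m (j + 1)) (UlevOf L m (n + 1) U j)) (cornerSite L y) κ (boxVec L r) : 𝔸ˣ) : 𝔸) - 1‖ ≤ αU j)
        {S : Subgroup 𝔸ˣ}, AvgClosed d L S → (∀ b, U b ∈ S) →
      ∀ {α : ℝ}, 0 ≤ α → α ≤ α₀ →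
        (∀ b, star (U b : 𝔸) = (((U b)⁻¹ : 𝔸ˣ) : 𝔸)) →
        (∀ b, ‖(U b : 𝔸) - 1‖ ≤ α * η) →
        (∀ p : B9SectCLatticeCarrier.Plaq d (towerP L m (n + 1)), ‖(plaqHolU U p : 𝔸) - 1‖ ≤ α * η ^ 2) →
        ∀ (hposU : ∀ x : BondL2K ℂ d (towerP L m (n + 1)) c₀ W, x ≠ 0 →
            0 < RCLike.re ⟪x, laplaceAk L m n φ η U hL αU hα1 hU1 hreg τ (c₀ := c₀) (c₁ := c₁) a x⟫_ℂ)
          (hpos1 : ∀ x : BondL2K ℂ d (towerP L m (n + 1)) c₀ W, x ≠ 0 →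
            0 < RCLike.re ⟪x, laplaceAk L m n φ η (fun _ : Bond d (towerP L m (n + 1)) => (1 : 𝔸ˣ)) hL (fun _ => 0) (fun _ => by norm_num)
              (perCfg_UlevOf_one_mem_U1 L m (n + 1)) (norm_Wcx_UlevOf_one_sub_one_le L m (n + 1) (fun _ => 0) (fun _ => le_rfl)) τ
              (c₀ := c₀) (c₁ := c₁) a x⟫_ℂ)
          (hQU : Function.Surjective (QkW L m n φ U hL αU hα1 hU1 hreg (c₀ := c₀) (c₁ := c₁)))
          (hQ1 : Function.Surjective (QkW L m n φ (fun _ : Bond d (towerP L m (n + 1)) => (1 : 𝔸ˣ)) hL (fun _ => 0) (fun _ => by norm_num)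
            (perCfg_UlevOf_one_mem_U1 L m (n + 1)) (norm_Wcx_UlevOf_one_sub_one_le L m (n + 1) (fun _ => 0) (fun _ => le_rfl)) (c₀ := c₀) (c₁ := c₁))),
        -- [G] the Green's function `G_k(U)`: bounds and Lipschitz rows at the flat point
        (∀ y : BondL2K ℂ d (towerP L m (n + 1)) c₀ W,
          ‖greenK (laplaceAk L m n φ η U hL αU hα1 hU1 hreg τ (c₀ := c₀) (c₁ := c₁) a) hposU y‖ ≤ C * ‖y‖ ∧
          ‖covCurlL2K ℂ c₀ ((η : ℂ))⁻¹ (adTransportW φ (fun _ : Bond d (towerP L m (n + 1)) => (1 : 𝔸ˣ)))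
            (greenK (laplaceAk L m n φ η U hL αU hα1 hU1 hreg τ (c₀ := c₀) (c₁ := c₁) a) hposU y)‖ ≤ C * ‖y‖ ∧
          ‖covDivL2K ℂ c₀ ((η : ℂ))⁻¹ (adTransportW φ fun _ : Bond d (towerP L m (n + 1)) => (1 : 𝔸ˣ)⁻¹)
            (greenK (laplaceAk L m n φ η U hL αU hα1 hU1 hreg τ (c₀ := c₀) (c₁ := c₁) a) hposU y)‖ ≤ C * ‖y‖ ∧
          ‖greenK (laplaceAk L m n φ η U hL αU hα1 hU1 hreg τ (c₀ := c₀) (c₁ := c₁) a) hposU y -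
            greenK (laplaceAk L m n φ η (fun _ : Bond d (towerP L m (n + 1)) => (1 : 𝔸ˣ)) hL (fun _ => 0) (fun _ => by norm_num)
              (perCfg_UlevOf_one_mem_U1 L m (n + 1)) (norm_Wcx_UlevOf_one_sub_one_le L m (n + 1) (fun _ => 0) (fun _ => le_rfl)) τ
              (c₀ := c₀) (c₁ := c₁) a) hpos1 y‖ ≤ C * α * ‖y‖ ∧
          ‖covCurlL2K ℂ c₀ ((η : ℂ))⁻¹ (adTransportW φ (fun _ : Bond d (towerP L m (n + 1)) => (1 : 𝔸ˣ)))
            (greenK (laplaceAk L m n φ η U hL αU hα1 hU1 hreg τ (c₀ := c₀) (c₁ := c₁) a) hposU y -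
            greenK (laplaceAk L m n φ η (fun _ : Bond d (towerP L m (n + 1)) => (1 : 𝔸ˣ)) hL (fun _ => 0) (fun _ => by norm_num)
              (perCfg_UlevOf_one_mem_U1 L m (n + 1)) (norm_Wcx_UlevOf_one_sub_one_le L m (n + 1) (fun _ => 0) (fun _ => le_rfl)) τ
              (c₀ := c₀) (c₁ := c₁) a) hpos1 y)‖ ≤ C * α * ‖y‖ ∧
          ‖covDivL2K ℂ c₀ ((η : ℂ))⁻¹ (adTransportW φ fun _ : Bond d (towerP L m (n + 1)) => (1 : 𝔸ˣ)⁻¹)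
            (greenK (laplaceAk L m n φ η U hL αU hα1 hU1 hreg τ (c₀ := c₀) (c₁ := c₁) a) hposU y -
            greenK (laplaceAk L m n φ η (fun _ : Bond d (towerP L m (n + 1)) => (1 : 𝔸ˣ)) hL (fun _ => 0) (fun _ => by norm_num)
              (perCfg_UlevOf_one_mem_U1 L m (n + 1)) (norm_Wcx_UlevOf_one_sub_one_le L m (n + 1) (fun _ => 0) (fun _ => le_rfl)) τ
              (c₀ := c₀) (c₁ := c₁) a) hpos1 y)‖ ≤ C * α * ‖y‖) ∧
        -- [HQG] the middle piece of (3.153): rows of `H_k(U)Q_k(U)G_k(U)`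
        (∀ y : BondL2K ℂ d (towerP L m (n + 1)) c₀ W,
          ‖H1LatticeK hposU hQU (QkW L m n φ U hL αU hα1 hU1 hreg (c₁ := c₁) (G1LatticeK hposU y))‖ ≤ C * ‖y‖ ∧
          ‖covCurlL2K ℂ c₀ ((η : ℂ))⁻¹ (adTransportW φ (fun _ : Bond d (towerP L m (n + 1)) => (1 : 𝔸ˣ)))
              (H1LatticeK hposU hQU (QkW L m n φ U hL αU hα1 hU1 hreg (c₁ := c₁) (G1LatticeK hposU y)))‖ ≤ C * ‖y‖ ∧
          ‖covDivL2K ℂ c₀ ((η : ℂ))⁻¹ (adTransportW φ fun _ : Bond d (towerP L m (n + 1)) => (1 : 𝔸ˣ)⁻¹)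
              (H1LatticeK hposU hQU (QkW L m n φ U hL αU hα1 hU1 hreg (c₁ := c₁) (G1LatticeK hposU y)))‖ ≤ C * ‖y‖) ∧
        -- [𝔊] the third Green's letter `𝔊_k(U)`: bounds and Lipschitz rows at the flat point
        (∀ x : BondL2K ℂ d (towerP L m (n + 1)) c₀ W,
          ‖frakGLatticeK hposU hQU x‖ ≤ C * ‖x‖ ∧
          ‖covCurlL2K ℂ c₀ ((η : ℂ))⁻¹ (adTransportW φ (fun _ : Bond d (towerP L m (n + 1)) => (1 : 𝔸ˣ))) (frakGLatticeK hposU hQU x)‖ ≤ C * ‖x‖ ∧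
          ‖covDivL2K ℂ c₀ ((η : ℂ))⁻¹ (adTransportW φ fun _ : Bond d (towerP L m (n + 1)) => (1 : 𝔸ˣ)⁻¹) (frakGLatticeK hposU hQU x)‖ ≤ C * ‖x‖ ∧
          ‖frakGLatticeK hposU hQU x - frakGLatticeK (c := ((η : ℂ))⁻¹) (R := adTransportW φ (fun _ : Bond d (towerP L m (n + 1)) => (1 : 𝔸ˣ)))
              (S := adTransportW φ fun _ : Bond d (towerP L m (n + 1)) => (1 : 𝔸ˣ)⁻¹) (Δ₁ := hessOp φ η (fun _ : Bond d (towerP L m (n + 1)) => (1 : 𝔸ˣ)) τ)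
              (Rr := RofUk L m n φ η (fun _ : Bond d (towerP L m (n + 1)) => (1 : 𝔸ˣ)))
              (Q := (QkW L m n φ (fun _ : Bond d (towerP L m (n + 1)) => (1 : 𝔸ˣ)) hL (fun _ => 0) (fun _ => by norm_num)
            (perCfg_UlevOf_one_mem_U1 L m (n + 1)) (norm_Wcx_UlevOf_one_sub_one_le L m (n + 1) (fun _ => 0) (fun _ => le_rfl)) (c₀ := c₀) (c₁ := c₁))) (a := a) hpos1 hQ1 x‖ ≤ C * α * ‖x‖ ∧
          ‖covCurlL2K ℂ c₀ ((η : ℂ))⁻¹ (adTransportW φ (fun _ : Bond d (towerP L m (n + 1)) => (1 : 𝔸ˣ)))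
            (frakGLatticeK hposU hQU x - frakGLatticeK (c := ((η : ℂ))⁻¹) (R := adTransportW φ (fun _ : Bond d (towerP L m (n + 1)) => (1 : 𝔸ˣ)))
              (S := adTransportW φ fun _ : Bond d (towerP L m (n + 1)) => (1 : 𝔸ˣ)⁻¹) (Δ₁ := hessOp φ η (fun _ : Bond d (towerP L m (n + 1)) => (1 : 𝔸ˣ)) τ)
              (Rr := RofUk L m n φ η (fun _ : Bond d (towerP L m (n + 1)) => (1 : 𝔸ˣ)))
              (Q := (QkW L m n φ (fun _ : Bond d (towerP L m (n + 1)) => (1 : 𝔸ˣ)) hL (fun _ => 0) (fun _ => by norm_num)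
            (perCfg_UlevOf_one_mem_U1 L m (n + 1)) (norm_Wcx_UlevOf_one_sub_one_le L m (n + 1) (fun _ => 0) (fun _ => le_rfl)) (c₀ := c₀) (c₁ := c₁))) (a := a) hpos1 hQ1 x)‖ ≤ C * α * ‖x‖ ∧
          ‖covDivL2K ℂ c₀ ((η : ℂ))⁻¹ (adTransportW φ fun _ : Bond d (towerP L m (n + 1)) => (1 : 𝔸ˣ)⁻¹)
            (frakGLatticeK hposU hQU x - frakGLatticeK (c := ((η : ℂ))⁻¹) (R := adTransportW φ (fun _ : Bond d (towerP L m (n + 1)) => (1 : 𝔸ˣ)))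
              (S := adTransportW φ fun _ : Bond d (towerP L m (n + 1)) => (1 : 𝔸ˣ)⁻¹) (Δ₁ := hessOp φ η (fun _ : Bond d (towerP L m (n + 1)) => (1 : 𝔸ˣ)) τ)
              (Rr := RofUk L m n φ η (fun _ : Bond d (towerP L m (n + 1)) => (1 : 𝔸ˣ)))
              (Q := (QkW L m n φ (fun _ : Bond d (towerP L m (n + 1)) => (1 : 𝔸ˣ)) hL (fun _ => 0) (fun _ => by norm_num)
            (perCfg_UlevOf_one_mem_U1 L m (n + 1)) (norm_Wcx_UlevOf_one_sub_one_le L m (n + 1) (fun _ => 0) (fun _ => le_rfl)) (c₀ := c₀) (c₁ := c₁))) (a := a) hpos1 hQ1 x)‖ ≤ C * α * ‖x‖) ∧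
        -- [H] the minimiser `H_k(U)`: bounds and Lipschitz rows at the flat point
        (∀ b : BondL2K ℂ d m c₁ W,
          ‖H1LatticeK hposU hQU b‖ ≤ C * ‖b‖ ∧
          ‖covCurlL2K ℂ c₀ ((η : ℂ))⁻¹ (adTransportW φ (fun _ : Bond d (towerP L m (n + 1)) => (1 : 𝔸ˣ))) (H1LatticeK hposU hQU b)‖ ≤ C * ‖b‖ ∧
          ‖covDivL2K ℂ c₀ ((η : ℂ))⁻¹ (adTransportW φ fun _ : Bond d (towerP L m (n + 1)) => (1 : 𝔸ˣ)⁻¹) (H1LatticeK hposU hQU b)‖ ≤ C * ‖b‖ ∧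
          ‖H1LatticeK hposU hQU b - H1LatticeK (c := ((η : ℂ))⁻¹) (R := adTransportW φ (fun _ : Bond d (towerP L m (n + 1)) => (1 : 𝔸ˣ)))
              (S := adTransportW φ fun _ : Bond d (towerP L m (n + 1)) => (1 : 𝔸ˣ)⁻¹) (Δ₁ := hessOp φ η (fun _ : Bond d (towerP L m (n + 1)) => (1 : 𝔸ˣ)) τ)
              (Rr := RofUk L m n φ η (fun _ : Bond d (towerP L m (n + 1)) => (1 : 𝔸ˣ)))
              (Q := (QkW L m n φ (fun _ : Bond d (towerP L m (n + 1)) => (1 : 𝔸ˣ)) hL (fun _ => 0) (fun _ => by norm_num)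
            (perCfg_UlevOf_one_mem_U1 L m (n + 1)) (norm_Wcx_UlevOf_one_sub_one_le L m (n + 1) (fun _ => 0) (fun _ => le_rfl)) (c₀ := c₀) (c₁ := c₁))) (a := a) hpos1 hQ1 b‖ ≤ C * α * ‖b‖ ∧
          ‖covCurlL2K ℂ c₀ ((η : ℂ))⁻¹ (adTransportW φ (fun _ : Bond d (towerP L m (n + 1)) => (1 : 𝔸ˣ)))
            (H1LatticeK hposU hQU b - H1LatticeK (c := ((η : ℂ))⁻¹) (R := adTransportW φ (fun _ : Bond d (towerP L m (n + 1)) => (1 : 𝔸ˣ)))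
              (S := adTransportW φ fun _ : Bond d (towerP L m (n + 1)) => (1 : 𝔸ˣ)⁻¹) (Δ₁ := hessOp φ η (fun _ : Bond d (towerP L m (n + 1)) => (1 : 𝔸ˣ)) τ)
              (Rr := RofUk L m n φ η (fun _ : Bond d (towerP L m (n + 1)) => (1 : 𝔸ˣ)))
              (Q := (QkW L m n φ (fun _ : Bond d (towerP L m (n + 1)) => (1 : 𝔸ˣ)) hL (fun _ => 0) (fun _ => by norm_num)
            (perCfg_UlevOf_one_mem_U1 L m (n + 1)) (norm_Wcx_UlevOf_one_sub_one_le L m (n + 1) (fun _ => 0) (fun _ => le_rfl)) (c₀ := c₀) (c₁ := c₁))) (a := a) hpos1 hQ1 b)‖ ≤ C * α * ‖b‖ ∧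
          ‖covDivL2K ℂ c₀ ((η : ℂ))⁻¹ (adTransportW φ fun _ : Bond d (towerP L m (n + 1)) => (1 : 𝔸ˣ)⁻¹)
            (H1LatticeK hposU hQU b - H1LatticeK (c := ((η : ℂ))⁻¹) (R := adTransportW φ (fun _ : Bond d (towerP L m (n + 1)) => (1 : 𝔸ˣ)))
              (S := adTransportW φ fun _ : Bond d (towerP L m (n + 1)) => (1 : 𝔸ˣ)⁻¹) (Δ₁ := hessOp φ η (fun _ : Bond d (towerP L m (n + 1)) => (1 : 𝔸ˣ)) τ)
              (Rr := RofUk L m n φ η (fun _ : Bond d (towerP L m (n + 1)) => (1 : 𝔸ˣ)))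
              (Q := (QkW L m n φ (fun _ : Bond d (towerP L m (n + 1)) => (1 : 𝔸ˣ)) hL (fun _ => 0) (fun _ => by norm_num)
            (perCfg_UlevOf_one_mem_U1 L m (n + 1)) (norm_Wcx_UlevOf_one_sub_one_le L m (n + 1) (fun _ => 0) (fun _ => le_rfl)) (c₀ := c₀) (c₁ := c₁))) (a := a) hpos1 hQ1 b)‖ ≤ C * α * ‖b‖) := by
  have hL0 : (0 : ℝ) < L := by exact_mod_cast lt_of_lt_of_le (by norm_num) hL2
  have hr0 : (0 : ℝ) ≤ 1 / (L : ℝ) := by positivity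
  have hr1 : 1 / (L : ℝ) < 1 := by rw [div_lt_one hL0]; exact_mod_cast lt_of_lt_of_le (by norm_num) hL2
  -- the OWNER's junction at `r = 1∕L`
  obtain ⟨α₁, C, hα₁, hC, H⟩ := exists_energy_ball_diagonal_closed hd L hL φ hMφ hMφ' hφ hφ' ha hr0 hr1 τ hτ hCτ hρw hτ₁ hτ₂ hφτ
  -- the α-linear feed below its threshold
  obtain ⟨T, hT, F⟩ := twoWindows_linear_feed L hL2 (d := d) (𝔸 := 𝔸) hα₁
  have hK1 : (1 : ℝ) ≤ 1 + 512 * (d + 1) * (d + 4) := by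
    have h0 : (0 : ℝ) ≤ 512 * (d + 1) * (d + 4) := by positivity
    linarith
  refine ⟨T, C * (1 + 512 * (d + 1) * (d + 4)), hT, by positivity, ?_⟩
  intro n η hηL hL3 c₀ c₁ _ _ hw hρ m _ U αU hα1 hU1 hreg S hS hU α hα0 hαle hUst hUη hpl hposU hpos1 hQU hQ1
  obtain ⟨hβ0, hβ1, hUb, hUη', hpl', -, εU, hεU, hUε, hεg⟩ := F m n hS hU hηL hα0 hαle hUη hpl
  obtain ⟨hG, hM, hF, hH⟩ := H n η hηL hL3 c₀ c₁ hw hρ m U αU hα1 hU1 hreg εU hεU hUε hβ0 hβ1 hUst hUb hUη' hpl' hεg hposU hpos1 hQU hQ1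
  -- bounds: `C·t ≤ (C·K)·t`; Lipschitz rows: `C·(Kα)·t = (C·K)·α·t`
  have hCK : ∀ t : ℝ, 0 ≤ t → C * t ≤ C * (1 + 512 * (d + 1) * (d + 4)) * t := fun t ht =>
    mul_le_mul_of_nonneg_right (le_mul_of_one_le_right hC.le hK1) ht
  have e : ∀ t : ℝ, C * ((1 + 512 * (d + 1) * (d + 4)) * α) * t = C * (1 + 512 * (d + 1) * (d + 4)) * α * t := fun t => by ring
  refine ⟨fun y => ?_, fun y => ?_, fun x => ?_, fun b => ?_⟩
  · obtain ⟨h1, h2, h3, h4, h5, h6⟩ := hG y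
    exact ⟨h1.trans (hCK _ (norm_nonneg _)), h2.trans (hCK _ (norm_nonneg _)), h3.trans (hCK _ (norm_nonneg _)),
      h4.trans_eq (e _), h5.trans_eq (e _), h6.trans_eq (e _)⟩
  · obtain ⟨h1, h2, h3⟩ := hM y
    exact ⟨h1.trans (hCK _ (norm_nonneg _)), h2.trans (hCK _ (norm_nonneg _)), h3.trans (hCK _ (norm_nonneg _))⟩
  · obtain ⟨h1, h2, h3, h4, h5, h6⟩ := hF x
    exact ⟨h1.trans (hCK _ (norm_nonneg _)), h2.trans (hCK _ (norm_nonneg _)), h3.trans (hCK _ (norm_nonneg _)),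
      h4.trans_eq (e _), h5.trans_eq (e _), h6.trans_eq (e _)⟩
  · obtain ⟨h1, h2, h3, h4, h5, h6⟩ := hH b
    exact ⟨h1.trans (hCK _ (norm_nonneg _)), h2.trans (hCK _ (norm_nonneg _)), h3.trans (hCK _ (norm_nonneg _)),
      h4.trans_eq (e _), h5.trans_eq (e _), h6.trans_eq (e _)⟩

end Literature.MathematicalPhysics.QuantumFieldTheory.Balaban1983to89.B9Eq3126EnergyBallTowerTwoWindows

end
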